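import Summits.CriticalPhenomena.PercolationContinuityZ3.Theorems.Transplant.SkelPhiQStepsN
import HarnessLib

/-!
# Quasi-step SELECTION with finite closures, I: the abstract selection lemma (entry lemma of the quasi strictness leg Q3)

builds on p205010 (kernel theorem, internal audit signed; external expert review pending) — nothing in this file uses p205010 and nothing here is a
percolation statement or a claim about any node.  Lane `prim-bschramm`, seat `prim-bschramm-p5` gen 30 (refuter / sharpness seat; planning memo
HOME/prim-bschramm-p5-g30/Q3-R1.md — Lemma A = `exists_extend`, Lemma B = `exists_goodSel`; P5-SHARPNESS §62.2; lead g24 GO 2026-08-27 18:51Z: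
helper rows, no rung).  Helper file (`--supports stmt-CriticalPhenomena-4575 --as helper`).
WHY.  The Aizenman–Grimmett regions of a strictness port over a quasi-step carrier (`Skelφ.QStepsN`: every unit chart move is a WALK of length `≤ N`
at the start value of the chart) must be finite and closed under the chosen step walks; interior vertices of a step walk stay in the chart fibre, and
an arbitrary choice of the walks can have INFINITE closures (Q3-R1.md §1: an explicit periodic carrier).  A GOOD choice always exists:
§1 (any graph `H`, two targets `P 0`, `P 1`, every vertex joined to each within length `m`): distances `pd`, geodesics, and the KEY INEQUALITY — along
an `i`-geodesic the potential `pd 0 + pd 1` does not increase, and where it stays equal the BACK-WALK through the start is a geodesic to the other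
target; §2 partial selections on finite domains and the EXTENSION LEMMA `exists_extend` (strong induction on the potential, first-piece-wins patching);
§3 the GLOBAL SELECTION `exists_goodSel` (enumeration patching over a countable vertex type): target walks of length `≤ m` at every vertex, every
closure under "add the supports of both chosen walks" FINITE.  The chart application (fibre graph, ports, `LinkN` step data, finite hulls) is the
sequel «SkelPhiQStepSelectionChart». [cite: AizenmanGrimmett1991, §2 (finite regions)] [cite: KozmaNitzan2024, §4 p. 19 (Step III)]
-/

noncomputable section

namespace Summit.CriticalPhenomena.PercolationContinuityZ3.Theorems.Transplant

namespace Skelφ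

namespace QSel

open SimpleGraph
open scoped Classical

variable {V : Type} {H : SimpleGraph V} {P : Fin 2 → Set V} {m : ℕ}

/-! ## §1 Distances to the two targets, geodesics, the key inequality -/

/-- The hypothesis of the abstract selection lemma: every vertex is joined to each target within length `m`. [this work] -/
def Joined (H : SimpleGraph V) (P : Fin 2 → Set V) (m : ℕ) : Prop :=
  ∀ (i : Fin 2) (v : V), ∃ u ∈ P i, ∃ p : H.Walk v u, p.length ≤ m

/-- The distance set is nonempty. [folklore] -/
theorem Joined.exists_eq (hJ : Joined H P m) (i : Fin 2) (v : V) : ∃ n, ∃ u ∈ P i, ∃ p : H.Walk v u, p.length = n := by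
  obtain ⟨u, hu, p, -⟩ := hJ i v; exact ⟨p.length, u, hu, p, rfl⟩

/-- **Distance to the target `P i`** (length of a shortest walk into `P i`). [this work] -/
def pd (hJ : Joined H P m) (i : Fin 2) (v : V) : ℕ := Nat.find (hJ.exists_eq i v)

/-- The distance is attained. [folklore] -/
theorem pd_spec (hJ : Joined H P m) (i : Fin 2) (v : V) :
    ∃ u ∈ P i, ∃ p : H.Walk v u, p.length = pd hJ i v := Nat.find_spec (hJ.exists_eq i v)

/-- The distance is minimal. [folklore] -/
theorem pd_le_length (hJ : Joined H P m) (i : Fin 2) {v u : V} (hu : u ∈ P i) (p : H.Walk v u) :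
    pd hJ i v ≤ p.length := Nat.find_min' _ ⟨u, hu, p, rfl⟩

/-- The distance is at most `m`. [folklore] -/
theorem pd_le_m (hJ : Joined H P m) (i : Fin 2) (v : V) : pd hJ i v ≤ m := by
  obtain ⟨u, hu, p, hp⟩ := hJ i v; exact (pd_le_length hJ i hu p).trans hp

/-- Walking first cannot beat the distance by more than the walk's length. [folklore] -/
theorem pd_le_length_add (hJ : Joined H P m) (i : Fin 2) {v x : V} (p : H.Walk v x) :
    pd hJ i v ≤ p.length + pd hJ i x := by
  obtain ⟨u, hu, q, hq⟩ := pd_spec hJ i x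
  have := pd_le_length hJ i hu (p.append q)
  rwa [Walk.length_append, hq] at this

/-- A geodesic: a target walk of length the distance. [this work] -/
def IsGeo (hJ : Joined H P m) (i : Fin 2) (v : V) (w : Σ u, H.Walk v u) : Prop :=
  w.1 ∈ P i ∧ w.2.length = pd hJ i v

/-- Geodesics exist. [folklore] -/
theorem exists_geo (hJ : Joined H P m) (i : Fin 2) (v : V) : ∃ w : Σ u, H.Walk v u, IsGeo hJ i v w := by
  obtain ⟨u, hu, p, hp⟩ := pd_spec hJ i v; exact ⟨⟨u, p⟩, hu, hp⟩

/-- **Along a geodesic the distance to its own target drops by the distance travelled.** [folklore] -/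
theorem pd_add_eq_of_geo (hJ : Joined H P m) {i : Fin 2} {v : V} {w : Σ u, H.Walk v u} (hw : IsGeo hJ i v w)
    {x : V} (hx : x ∈ w.2.support) :
    pd hJ i x + (w.2.takeUntil x hx).length = pd hJ i v := by
  have hsplit := congr_arg Walk.length (w.2.take_spec hx)
  rw [Walk.length_append, hw.2] at hsplit
  have h1 : pd hJ i x ≤ (w.2.dropUntil x hx).length := pd_le_length hJ i hw.1 _
  have h2 : pd hJ i v ≤ (w.2.takeUntil x hx).length + pd hJ i x := pd_le_length_add hJ i _
  omega

/-- The tail of a geodesic is a geodesic. [folklore] -/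
theorem isGeo_dropUntil (hJ : Joined H P m) {i : Fin 2} {v : V} {w : Σ u, H.Walk v u} (hw : IsGeo hJ i v w)
    {x : V} (hx : x ∈ w.2.support) : IsGeo hJ i x ⟨w.1, w.2.dropUntil x hx⟩ := by
  refine ⟨hw.1, ?_⟩
  have hsplit := congr_arg Walk.length (w.2.take_spec hx)
  rw [Walk.length_append, hw.2] at hsplit
  have := pd_add_eq_of_geo hJ hw hx
  show (w.2.dropUntil x hx).length = pd hJ i x
  omega

/-- **The back-walk bound**: the distance to ANY target at a geodesic vertex is at most the distance travelled plus the start's distance. [folklore] -/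
theorem pd_le_of_mem_support (hJ : Joined H P m) (j : Fin 2) {v u : V} (p : H.Walk v u) {x : V} (hx : x ∈ p.support) :
    pd hJ j x ≤ (p.takeUntil x hx).length + pd hJ j v := by
  have := pd_le_length_add hJ j (p.takeUntil x hx).reverse; rwa [Walk.length_reverse] at this

/-- The potential. [this work] -/
def S (hJ : Joined H P m) (v : V) : ℕ := pd hJ 0 v + pd hJ 1 v

/-- The other index of `Fin 2`. [folklore] -/
def other (i : Fin 2) : Fin 2 := ⟨1 - i.1, by omega⟩

/-- The index different from `i` is `other i`. [folklore] -/
theorem eq_other_of_ne {i j : Fin 2} (h : j ≠ i) : j = other i := by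
  have h' := Fin.val_ne_of_ne h; have := i.2; have := j.2; exact Fin.ext (by simp only [other]; omega)

/-- The potential split at any index. [folklore] -/
theorem S_eq (hJ : Joined H P m) (i : Fin 2) (v : V) : S hJ v = pd hJ i v + pd hJ (other i) v := by
  unfold S
  rcases Fin.exists_fin_two.mp ⟨i, rfl⟩ with h | h
  · rw [h]; rfl
  · rw [h, add_comm]; rfl

/-- **KEY INEQUALITY**: along an `i`-geodesic the potential does not increase … [this work] -/
theorem S_le_of_geo (hJ : Joined H P m) {i : Fin 2} {v : V} {w : Σ u, H.Walk v u} (hw : IsGeo hJ i v w)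
    {x : V} (hx : x ∈ w.2.support) : S hJ x ≤ S hJ v := by
  rw [S_eq hJ i x, S_eq hJ i v]
  have h1 := pd_add_eq_of_geo hJ hw hx
  have h2 := pd_le_of_mem_support hJ (other i) w.2 hx
  omega

/-- … and where it stays equal, the BACK-WALK through the start followed by a geodesic to the other target is a geodesic. [this work] -/
theorem isGeo_backWalk (hJ : Joined H P m) {i : Fin 2} {v : V} {w : Σ u, H.Walk v u} (hw : IsGeo hJ i v w)
    {w' : Σ u, H.Walk v u} (hw' : IsGeo hJ (other i) v w') {x : V} (hx : x ∈ w.2.support) (hS : S hJ x = S hJ v) :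
    IsGeo hJ (other i) x ⟨w'.1, (w.2.takeUntil x hx).reverse.append w'.2⟩ := by
  refine ⟨hw'.1, ?_⟩
  show ((w.2.takeUntil x hx).reverse.append w'.2).length = pd hJ (other i) x
  rw [Walk.length_append, Walk.length_reverse, hw'.2]
  rw [S_eq hJ i x, S_eq hJ i v] at hS
  have h1 := pd_add_eq_of_geo hJ hw hx
  omega

/-! ## §2 Partial selections and the extension lemma -/

variable (H P m) in
/-- **A partial selection**: target walks of length `≤ m` chosen on a finite domain (the walks off the domain are junk). [this work] -/
structure PSel where
  /-- the domain -/
  dom : Finset V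
  /-- the chosen walks (meaningful on `dom`) -/
  sel : Fin 2 → (v : V) → Σ u, H.Walk v u
  /-- on the domain the walks hit the targets within length `m` -/
  good : ∀ i, ∀ v ∈ dom, (sel i v).1 ∈ P i ∧ (sel i v).2.length ≤ m

namespace PSel

/-- Extension of partial selections: larger domain, same walks on the old domain. [this work] -/
def LE (Q Q' : PSel H P m) : Prop := Q.dom ⊆ Q'.dom ∧ ∀ i, ∀ v ∈ Q.dom, Q'.sel i v = Q.sel i v

/-- Reflexivity. [folklore] -/
theorem le_refl (Q : PSel H P m) : Q.LE Q := ⟨subset_rfl, fun _ _ _ => rfl⟩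

/-- Transitivity. [folklore] -/
theorem LE.trans {Q Q' Q'' : PSel H P m} (h : Q.LE Q') (h' : Q'.LE Q'') : Q.LE Q'' :=
  ⟨h.1.trans h'.1, fun i v hv => (h'.2 i v (h.1 hv)).trans (h.2 i v hv)⟩

/-- Closed: every chosen walk on the domain stays in the domain. [this work] -/
def Closed (Q : PSel H P m) : Prop := ∀ i, ∀ v ∈ Q.dom, ∀ x ∈ (Q.sel i v).2.support, x ∈ Q.dom

/-- Relatively closed: the walks of the NEW vertices stay in the new domain. [this work] -/
def RelClosed (Q Q' : PSel H P m) : Prop :=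
  ∀ i, ∀ v ∈ Q'.dom, v ∉ Q.dom → ∀ x ∈ (Q'.sel i v).2.support, x ∈ Q'.dom

/-- A relatively closed extension of a closed partial selection is closed. [this work] -/
theorem closed_of_relClosed {Q Q' : PSel H P m} (hQ : Q.Closed) (hle : Q.LE Q') (hrel : RelClosed Q Q') : Q'.Closed := by
  intro i v hv x hx
  by_cases hvQ : v ∈ Q.dom
  · rw [hle.2 i v hvQ] at hx
    exact hle.1 (hQ i v hvQ x hx)
  · exact hrel i v hv hvQ x hx

/-- Add one vertex with prescribed target walks. [this work] -/
def insert (Q : PSel H P m) (v : V) (w : Fin 2 → Σ u, H.Walk v u) (hw : ∀ i, (w i).1 ∈ P i ∧ (w i).2.length ≤ m) :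
    PSel H P m where
  dom := Insert.insert v Q.dom
  sel i := Function.update (Q.sel i) v (w i)
  good i x hx := by
    by_cases h : x = v
    · subst h; rw [Function.update_self]; exact hw i
    · rw [Function.update_of_ne h]; exact Q.good i x ((Finset.mem_insert.mp hx).resolve_left h)

/-- Inserting a new vertex is an extension. [folklore] -/
theorem le_insert (Q : PSel H P m) {v : V} (hv : v ∉ Q.dom) (w : Fin 2 → Σ u, H.Walk v u)
    (hw : ∀ i, (w i).1 ∈ P i ∧ (w i).2.length ≤ m) : Q.LE (Q.insert v w hw) := by
  refine ⟨Finset.subset_insert _ _, fun i x hx => ?_⟩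
  exact Function.update_of_ne (show x ≠ v from fun h => hv (h ▸ hx)) _ _

/-- The inserted vertex carries the prescribed walks. [folklore] -/
theorem insert_sel_self (Q : PSel H P m) (v : V) (w : Fin 2 → Σ u, H.Walk v u)
    (hw : ∀ i, (w i).1 ∈ P i ∧ (w i).2.length ≤ m) (i : Fin 2) : (Q.insert v w hw).sel i v = w i := by
  show Function.update (Q.sel i) v (w i) v = w i; exact Function.update_self _ _ _

/-- Membership in the enlarged domain. [folklore] -/
theorem mem_insert_dom_iff (Q : PSel H P m) (v : V) (w : Fin 2 → Σ u, H.Walk v u)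
    (hw : ∀ i, (w i).1 ∈ P i ∧ (w i).2.length ≤ m) {x : V} : x ∈ (Q.insert v w hw).dom ↔ x = v ∨ x ∈ Q.dom :=
  Finset.mem_insert

end PSel

open PSel in
/-- **THE EXTENSION LEMMA**: every partial selection extends, relatively closed, to one containing any given vertex.  Strong induction on the
potential `S`: the new vertex gets two geodesics; a support vertex of smaller potential is served by the induction hypothesis, one of equal potential
by the tail of its geodesic and the BACK-WALK (first piece wins). [this work] -/
theorem exists_extend (hJ : Joined H P m) (s : ℕ) :
    ∀ v, S hJ v ≤ s → ∀ Q : PSel H P m, ∃ Q' : PSel H P m, Q.LE Q' ∧ v ∈ Q'.dom ∧ RelClosed Q Q' := by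
  induction s using Nat.strong_induction_on with
  | _ s ih =>
  intro v hvs Q
  by_cases hvQ : v ∈ Q.dom
  · exact ⟨Q, (le_refl _), hvQ, fun i x hx hxQ => (hxQ hx).elim⟩
  have hgeo : ∀ i, ∃ w : Σ u, H.Walk v u, IsGeo hJ i v w := fun i => exists_geo hJ i v
  choose w hw using hgeo
  have hwgood : ∀ i, (w i).1 ∈ P i ∧ (w i).2.length ≤ m := fun i => ⟨(hw i).1, (hw i).2 ▸ pd_le_m hJ i v⟩
  set Q₁ := Q.insert v w hwgood with hQ₁
  have hle₁ : Q.LE Q₁ := Q.le_insert hvQ w hwgood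
  let T : Set V := {y | y ∈ (w 0).2.support ∨ y ∈ (w 1).2.support}
  have hTi : ∀ i, ∀ y ∈ (w i).2.support, y ∈ T := by
    intro i y hy
    rcases Fin.exists_fin_two.mp ⟨i, rfl⟩ with h | h
    · exact Or.inl (h ▸ hy)
    · exact Or.inr (h ▸ hy)
  let Inv : PSel H P m → Prop := fun R => ∀ i, ∀ x ∈ R.dom, x ∉ Q.dom → ∀ y ∈ (R.sel i x).2.support, y ∈ R.dom ∨ y ∈ T
  have hInv₁ : Inv Q₁ := by
    intro i x hx hxQ y hy
    have hxv : x = v := ((Q.mem_insert_dom_iff v w hwgood).mp hx).resolve_right hxQ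
    subst hxv
    rw [hQ₁, Q.insert_sel_self] at hy
    exact Or.inr (hTi i y hy)
  have hserve : ∀ (R : PSel H P m), Q₁.LE R → Inv R → ∀ x, x ∈ T → x ∉ R.dom → ¬ S hJ x < s →
      ∃ R' : PSel H P m, R.LE R' ∧ x ∈ R'.dom ∧ Inv R' := by
    intro R hR hIR x hxT hxR hSx
    have hxi : ∃ i, x ∈ (w i).2.support := by
      rcases hxT with h | h
      · exact ⟨0, h⟩
      · exact ⟨1, h⟩
    obtain ⟨i, hxi⟩ := hxi
    have hSle : S hJ x ≤ S hJ v := S_le_of_geo hJ (hw i) hxi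
    have hSeq : S hJ x = S hJ v := by omega
    let w' : Fin 2 → Σ u, H.Walk x u := fun j =>
      if j = i then ⟨(w i).1, (w i).2.dropUntil x hxi⟩
      else ⟨(w (other i)).1, ((w i).2.takeUntil x hxi).reverse.append (w (other i)).2⟩
    have hw'i : w' i = ⟨(w i).1, (w i).2.dropUntil x hxi⟩ := by simp only [w', if_pos rfl]
    have hw'o : ∀ j, j ≠ i →
        w' j = ⟨(w (other i)).1, ((w i).2.takeUntil x hxi).reverse.append (w (other i)).2⟩ :=
      fun j hj => by simp only [w', if_neg hj]
    have hw'geo : ∀ j, IsGeo hJ j x (w' j) := by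
      intro j
      by_cases hj : j = i
      · subst hj; rw [hw'i]; exact isGeo_dropUntil hJ (hw j) hxi
      · rw [hw'o j hj, eq_other_of_ne hj]
        exact isGeo_backWalk hJ (hw i) (hw (other i)) hxi hSeq
    have hw'good : ∀ j, (w' j).1 ∈ P j ∧ (w' j).2.length ≤ m := fun j => ⟨(hw'geo j).1, (hw'geo j).2 ▸ pd_le_m hJ j x⟩
    have hw'T : ∀ j, ∀ y ∈ (w' j).2.support, y ∈ T := by
      intro j y hy
      by_cases hj : j = i
      · subst hj; rw [hw'i] at hy
        exact hTi j y ((w j).2.support_dropUntil_subset_support hxi hy)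
      · rw [hw'o j hj] at hy
        rcases (Walk.mem_support_append_iff _ _).mp hy with hy | hy
        · rw [Walk.support_reverse, List.mem_reverse] at hy
          exact hTi i y ((w i).2.support_takeUntil_subset_support hxi hy)
        · exact hTi (other i) y hy
    refine ⟨R.insert x w' hw'good, R.le_insert hxR w' hw'good, Finset.mem_insert_self _ _, ?_⟩
    intro j y hy hyQ z hz
    rcases (R.mem_insert_dom_iff x w' hw'good).mp hy with rfl | hyR
    · rw [R.insert_sel_self] at hz
      exact Or.inr (hw'T j z hz)
    · rw [(R.le_insert hxR w' hw'good).2 j y hyR] at hz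
      rcases hIR j y hyR hyQ z hz with h | h
      · exact Or.inl ((R.le_insert hxR w' hw'good).1 h)
      · exact Or.inr h
  have hlist : ∀ L : List V, (∀ x ∈ L, x ∈ T) → ∀ R : PSel H P m, Q₁.LE R → Inv R →
      ∃ R' : PSel H P m, R.LE R' ∧ (∀ x ∈ L, x ∈ R'.dom) ∧ Inv R' := by
    intro L
    induction L with
    | nil => intro _ R _ hIR; exact ⟨R, (le_refl _), fun x hx => (List.not_mem_nil hx).elim, hIR⟩
    | cons x L ihL =>
      intro hL R hR hIR
      have hxT : x ∈ T := hL x (List.mem_cons_self)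
      have hL' : ∀ y ∈ L, y ∈ T := fun y hy => hL y (List.mem_cons_of_mem x hy)
      have hx : ∃ R₂ : PSel H P m, R.LE R₂ ∧ x ∈ R₂.dom ∧ Inv R₂ := by
        by_cases hxR : x ∈ R.dom
        · exact ⟨R, (le_refl _), hxR, hIR⟩
        by_cases hSx : S hJ x < s
        · obtain ⟨R₂, hle₂, hx₂, hrel₂⟩ := ih (S hJ x) hSx x le_rfl R
          refine ⟨R₂, hle₂, hx₂, fun j y hy hyQ z hz => ?_⟩
          by_cases hyR : y ∈ R.dom
          · rw [hle₂.2 j y hyR] at hz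
            rcases hIR j y hyR hyQ z hz with h | h
            · exact Or.inl (hle₂.1 h)
            · exact Or.inr h
          · exact Or.inl (hrel₂ j y hy hyR z hz)
        · exact hserve R hR hIR x hxT hxR hSx
      obtain ⟨R₂, hle₂, hx₂, hI₂⟩ := hx
      obtain ⟨R₃, hle₃, hL₃, hI₃⟩ := ihL hL' R₂ (hR.trans hle₂) hI₂
      exact ⟨R₃, hle₂.trans hle₃, fun y hy => by
        rcases List.mem_cons.mp hy with rfl | hy
        · exact hle₃.1 hx₂
        · exact hL₃ y hy, hI₃⟩
  obtain ⟨R, hleR, hLR, hIR⟩ := hlist ((w 0).2.support ++ (w 1).2.support)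
    (fun x hx => by
      rcases List.mem_append.mp hx with h | h
      · exact Or.inl h
      · exact Or.inr h) Q₁ (le_refl _) hInv₁
  have hTR : ∀ y ∈ T, y ∈ R.dom := fun y hy => hLR y (List.mem_append.mpr hy)
  refine ⟨R, hle₁.trans hleR, hleR.1 (Finset.mem_insert_self _ _), fun i x hx hxQ y hy => ?_⟩
  rcases hIR i x hx hxQ y hy with h | h
  · exact h
  · exact hTR y h

/-! ## §3 The global selection -/

/-- The empty partial selection. [this work] -/
def PSel.empty (H : SimpleGraph V) (P : Fin 2 → Set V) (m : ℕ) : PSel H P m where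
  dom := ∅
  sel _ v := ⟨v, Walk.nil⟩
  good _ v hv := (Finset.notMem_empty v hv).elim

/-- **The stages** of the enumeration patching: stage `n + 1` extends stage `n` (relatively closed) so as to contain the `n`-th vertex. [this work] -/
def stage (hJ : Joined H P m) (e : ℕ → V) : ℕ → PSel H P m
  | 0 => PSel.empty H P m
  | n + 1 => Classical.choose (exists_extend hJ (S hJ (e n)) (e n) le_rfl (stage hJ e n))

/-- The defining property of the successor stage. [this work] -/
theorem stage_succ_spec (hJ : Joined H P m) (e : ℕ → V) (n : ℕ) :
    (stage hJ e n).LE (stage hJ e (n + 1)) ∧ e n ∈ (stage hJ e (n + 1)).dom ∧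
      PSel.RelClosed (stage hJ e n) (stage hJ e (n + 1)) :=
  Classical.choose_spec (exists_extend hJ (S hJ (e n)) (e n) le_rfl (stage hJ e n))

/-- Every stage is closed. [this work] -/
theorem stage_closed (hJ : Joined H P m) (e : ℕ → V) : ∀ n, (stage hJ e n).Closed
  | 0 => fun _ v hv => (Finset.notMem_empty v hv).elim
  | n + 1 => PSel.closed_of_relClosed (stage_closed hJ e n) (stage_succ_spec hJ e n).1 (stage_succ_spec hJ e n).2.2

/-- The stages increase. [this work] -/
theorem stage_mono (hJ : Joined H P m) (e : ℕ → V) {n k : ℕ} (h : n ≤ k) : (stage hJ e n).LE (stage hJ e k) := by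
  induction h with
  | refl => exact PSel.le_refl _
  | step _ ih => exact ih.trans (stage_succ_spec hJ e _).1

/-- The selected walks agree across all stages containing the vertex. [this work] -/
theorem stage_sel_eq (hJ : Joined H P m) (e : ℕ → V) {n k : ℕ} {v : V} (hn : v ∈ (stage hJ e n).dom)
    (hk : v ∈ (stage hJ e k).dom) (i : Fin 2) : (stage hJ e k).sel i v = (stage hJ e n).sel i v := by
  rcases le_total n k with h | h; exacts [(stage_mono hJ e h).2 i v hn, ((stage_mono hJ e h).2 i v hk).symm]

/-- **The global selection** along an enumeration `e` (with a right inverse `g`): the walks of the first stage containing the vertex. [this work] -/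
def gsel (hJ : Joined H P m) (e : ℕ → V) (g : V → ℕ) (i : Fin 2) (v : V) : Σ u, H.Walk v u :=
  (stage hJ e (g v + 1)).sel i v

/-- The `g v + 1`-st stage contains `v`. [this work] -/
theorem mem_stage_dom (hJ : Joined H P m) {e : ℕ → V} {g : V → ℕ} (hg : ∀ v, e (g v) = v) (v : V) :
    v ∈ (stage hJ e (g v + 1)).dom := by
  have := (stage_succ_spec hJ e (g v)).2.1
  rwa [hg] at this

/-- The global selection agrees with every stage containing the vertex. [this work] -/
theorem gsel_eq_of_mem (hJ : Joined H P m) {e : ℕ → V} {g : V → ℕ} (hg : ∀ v, e (g v) = v) {k : ℕ} {v : V}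
    (hk : v ∈ (stage hJ e k).dom) (i : Fin 2) : gsel hJ e g i v = (stage hJ e k).sel i v :=
  stage_sel_eq hJ e hk (mem_stage_dom hJ hg v) i

/-- The closure relation of a selection: `b` lies on one of the two chosen walks at `a`. [this work] -/
def Rel (sel : Fin 2 → (v : V) → Σ u, H.Walk v u) (a b : V) : Prop := ∃ i, b ∈ (sel i a).2.support

/-- **Every closure of the global selection is finite**: it stays inside the (finite, closed) first stage containing the vertex. [this work] -/
theorem reach_subset_stage (hJ : Joined H P m) {e : ℕ → V} {g : V → ℕ} (hg : ∀ v, e (g v) = v) (v : V) :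
    {x | Relation.ReflTransGen (Rel (gsel hJ e g)) v x} ⊆ ↑(stage hJ e (g v + 1)).dom := by
  intro x hx
  induction hx with
  | refl => exact mem_stage_dom hJ hg v
  | tail _ hbc ih =>
    obtain ⟨i, hi⟩ := hbc
    rw [gsel_eq_of_mem hJ hg ih i] at hi
    exact stage_closed hJ e _ i _ ih _ hi

variable (H P m) in
/-- **A good selection**: target walks of length `≤ m` at every vertex, all closures finite. [this work] -/
def GoodSel (sel : Fin 2 → (v : V) → Σ u, H.Walk v u) : Prop :=
  (∀ i v, (sel i v).1 ∈ P i ∧ (sel i v).2.length ≤ m) ∧ ∀ v, {x | Relation.ReflTransGen (Rel sel) v x}.Finite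

/-- **THE SELECTION LEMMA** (abstract form): on a countable vertex type, if every vertex is joined to each of two targets within length `m`,
there is a choice of such walks at every vertex ALL of whose closures ("keep adding the supports of the chosen walks") are finite. [this work] -/
theorem exists_goodSel [Countable V] (hJ : Joined H P m) : ∃ sel : Fin 2 → (v : V) → Σ u, H.Walk v u, GoodSel H P m sel := by
  rcases isEmpty_or_nonempty V with hV | hV
  · exact ⟨fun _ v => ⟨v, Walk.nil⟩, fun _ v => isEmptyElim v, fun v => isEmptyElim v⟩
  obtain ⟨e, he⟩ := exists_surjective_nat V
  choose g hg using he
  refine ⟨gsel hJ e g, fun i v => ?_, fun v => (stage hJ e (g v + 1)).dom.finite_toSet.subset (reach_subset_stage hJ hg v)⟩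
  exact (stage hJ e (g v + 1)).good i v (mem_stage_dom hJ hg v)

end QSel

end Skelφ

end Summit.CriticalPhenomena.PercolationContinuityZ3.Theorems.Transplant

end
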